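import Summits.Ventures.CertifiedQuantumChemistry.Statement
import HarnessLib

/-!
# Ventures/CertifiedQuantumChemistry — Rows/DifferenceRows.lean: DIFFERENCE rows
# `dE = E₀(H[F_A]; a, b) − E₀(H[F_B]; a′, b′)` and the `dE-from-absolutes` rule (width `W_A + W_B`)

HONEST FRAMING (verbatim): certified bounds for a stated model Hamiltonian in a stated basis; not a
claim about the real molecule or material beyond that model.

LADDER-CHEM (D-0105 (1)) makes RELATIVE energies the certified quantity of record (rung R2): a
reaction step is a PAIR of pinned model files `(F_A, F_B)` — two intermediates, two geometries, a bound
and an unbound cluster — each read as a `Model k` of `Statement.lean`, each with its own sector, and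
the row key `dE@fcidump:<sha8A>-<sha8B>:Na<a>:Nb<b>` (or `…:<sha8A>:Na<a>:Nb<b>-<sha8B>:Na<a′>:Nb<b′>`
when the sectors differ) names the number `Model.energy F_A a b − Model.energy F_B a′ b′`
(START-HERE.md §3.1; ORACLE-SPEC.md §1.3). This file TYPES that quantity and its one-sided / two-sided
ROW PREDICATES exactly in the shape of the absolute rows `LowerRow` / `UpperRow` / `Bracket`
(explicit rational slots; the physical ranges of BOTH sectors are part of the row, so no difference row
is statable where either energy is the junk value `sInf ∅ = 0`), and PROVES the cell's first — always
valid, never informative at transition-metal scale — difference rule, ORACLE-SPEC §1.3 (i)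
`dE-from-absolutes`: "ΔE_L = L_A − U_B, ΔE_U = U_A − L_B from four refereed absolute rows (always
valid; width W_A + W_B)" (REFEREE-CHEM.md §1.4 «I-DIFF-trivial»): two certified brackets give a
certified difference bracket by interval subtraction, whose width is the SUM of the two absolute widths
(`sub_sub_sub_eq`: an identity on the slots). Everything else here is slot algebra a referee or the
oracle API uses when tabling difference rows: weakening, consistency `lo ≤ hi`, antisymmetry under
swapping the pair, CHAINING along a path `A → B → C` (thermodynamic cycles:
`E_A − E_C = (E_A − E_B) + (E_B − E_C)`), transport of an absolute row across a difference row
(certify `F_B` absolutely once, then every partner `F_A` through its difference row), the falsification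
shape `|dE − ref| ≤ hi − lo`, and the decidable STEP-0 test of LADDER-CHEM §1 row I-DIFF
("certified W(ΔE) < ½ (W_A + W_B)") as a predicate on six rational slots.

What is NOT here (slot 09 of the I-TYPE rung, chem-type-09 / chem-solver-4): the DIFFERENCE
CERTIFICATES themselves — ORACLE-SPEC §1.3 (ii) `dE-direct:<class>`, class (a) joint SDP over
`H_A ⊕ H_B` with shared multipliers, (b) certified continuation / Lipschitz–concavity bounds along a
line of integral tables (in-tree seeds: `Rows/SectorEnergyConcavity.lean`
`abs_sectorGroundEnergy_sub_le`, `concaveOn_sectorGroundEnergy_line`), (c) common-fragment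
certificates — each of which will conclude one of the predicates `DiffLowerRow` / `DiffUpperRow`
below with a width SMALLER than `W_A + W_B`. Nothing in this file asserts any bound; no definition
here has analytic content beyond subtraction. Typed by chem-type-01 (LADDER-CHEM I-TYPE, cell
chem-oracle) as the baseline object the `dE-direct` lemmas refine.
-/

noncomputable section

namespace Summit.Ventures.CertifiedQuantumChemistry

variable {kA kB kC : ℕ}

/-! ## The difference quantity and its row predicates -/

/-- THE CERTIFIED DIFFERENCE QUANTITY of a pinned pair: `dE = E₀(H[F_A]; a, b) − E₀(H[F_B]; a′, b′)`,
the difference of the two sector ground-state energies `Model.energy` (row key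
`dE@fcidump:<sha8A>-<sha8B>:…`, START-HERE §3.1). Like `Model.energy` it carries JUNK VALUES off the
physical ranges `a ≤ kA ∧ b ≤ kA`, `a′ ≤ kB ∧ b′ ≤ kB`; the row predicates below carry both ranges. -/
def Model.energyDiff (FA : Model kA) (a b : ℕ) (FB : Model kB) (a' b' : ℕ) : ℝ :=
  FA.energy a b - FB.energy a' b'

/-- DIFFERENCE LOWER row: both sectors exist and the rational `lo` bounds the difference from below,
`(lo : ℝ) ≤ E₀(H[F_A]; a, b) − E₀(H[F_B]; a′, b′)` (the `ΔE_L` slot of ORACLE-SPEC §1.3). -/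
def DiffLowerRow (FA : Model kA) (a b : ℕ) (FB : Model kB) (a' b' : ℕ) (lo : ℚ) : Prop :=
  (a ≤ kA ∧ b ≤ kA) ∧ (a' ≤ kB ∧ b' ≤ kB) ∧ ((lo : ℚ) : ℝ) ≤ FA.energy a b - FB.energy a' b'

/-- DIFFERENCE UPPER row: both sectors exist and `E₀(H[F_A]; a, b) − E₀(H[F_B]; a′, b′) ≤ (hi : ℝ)`
(the `ΔE_U` slot of ORACLE-SPEC §1.3). -/
def DiffUpperRow (FA : Model kA) (a b : ℕ) (FB : Model kB) (a' b' : ℕ) (hi : ℚ) : Prop :=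
  (a ≤ kA ∧ b ≤ kA) ∧ (a' ≤ kB ∧ b' ≤ kB) ∧ FA.energy a b - FB.energy a' b' ≤ ((hi : ℚ) : ℝ)

/-- Two-sided DIFFERENCE row (certified difference bracket `[ΔE_L, ΔE_U]` of ORACLE-SPEC §1.3) =
lower ∧ upper, each side with its own provenance (`dE-from-absolutes` below, or a `dE-direct`
certificate of slot 09). -/
def DiffBracket (FA : Model kA) (a b : ℕ) (FB : Model kB) (a' b' : ℕ) (lo hi : ℚ) : Prop :=
  DiffLowerRow FA a b FB a' b' lo ∧ DiffUpperRow FA a b FB a' b' hi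

/-- The difference bracket is exactly the conjunction of the one-sided difference rows. -/
theorem diffBracket_iff (FA : Model kA) (a b : ℕ) (FB : Model kB) (a' b' : ℕ) (lo hi : ℚ) :
    DiffBracket FA a b FB a' b' lo hi ↔ DiffLowerRow FA a b FB a' b' lo ∧ DiffUpperRow FA a b FB a' b' hi :=
  Iff.rfl

/-- The inequality of a difference lower row, spelled with `Model.energyDiff`. -/
theorem DiffLowerRow.le {FA : Model kA} {a b : ℕ} {FB : Model kB} {a' b' : ℕ} {lo : ℚ}
    (h : DiffLowerRow FA a b FB a' b' lo) : ((lo : ℚ) : ℝ) ≤ FA.energyDiff a b FB a' b' :=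
  h.2.2

/-- The inequality of a difference upper row, spelled with `Model.energyDiff`. -/
theorem DiffUpperRow.le {FA : Model kA} {a b : ℕ} {FB : Model kB} {a' b' : ℕ} {hi : ℚ}
    (h : DiffUpperRow FA a b FB a' b' hi) : FA.energyDiff a b FB a' b' ≤ ((hi : ℚ) : ℝ) :=
  h.2.2

/-- A difference lower row lives on the physical ranges of BOTH sectors. -/
theorem DiffLowerRow.range {FA : Model kA} {a b : ℕ} {FB : Model kB} {a' b' : ℕ} {lo : ℚ}
    (h : DiffLowerRow FA a b FB a' b' lo) : (a ≤ kA ∧ b ≤ kA) ∧ (a' ≤ kB ∧ b' ≤ kB) :=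
  ⟨h.1, h.2.1⟩

/-- A difference upper row lives on the physical ranges of BOTH sectors. -/
theorem DiffUpperRow.range {FA : Model kA} {a b : ℕ} {FB : Model kB} {a' b' : ℕ} {hi : ℚ}
    (h : DiffUpperRow FA a b FB a' b' hi) : (a ≤ kA ∧ b ≤ kA) ∧ (a' ≤ kB ∧ b' ≤ kB) :=
  ⟨h.1, h.2.1⟩

/-- A difference lower row may be weakened downwards. -/
theorem DiffLowerRow.mono {FA : Model kA} {a b : ℕ} {FB : Model kB} {a' b' : ℕ} {lo lo' : ℚ}
    (h : DiffLowerRow FA a b FB a' b' lo) (hle : lo' ≤ lo) : DiffLowerRow FA a b FB a' b' lo' :=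
  ⟨h.1, h.2.1, le_trans (by exact_mod_cast hle) h.2.2⟩

/-- A difference upper row may be weakened upwards. -/
theorem DiffUpperRow.mono {FA : Model kA} {a b : ℕ} {FB : Model kB} {a' b' : ℕ} {hi hi' : ℚ}
    (h : DiffUpperRow FA a b FB a' b' hi) (hle : hi ≤ hi') : DiffUpperRow FA a b FB a' b' hi' :=
  ⟨h.1, h.2.1, le_trans h.2.2 (by exact_mod_cast hle)⟩

/-- Consistency of a difference bracket: `lo ≤ hi` (a difference bracket with `hi < lo` is an EVENT:
one of the certificates, or one of the two model identities, is wrong). -/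
theorem DiffBracket.lo_le_hi {FA : Model kA} {a b : ℕ} {FB : Model kB} {a' b' : ℕ} {lo hi : ℚ}
    (h : DiffBracket FA a b FB a' b' lo hi) : lo ≤ hi := by
  have h' : ((lo : ℚ) : ℝ) ≤ ((hi : ℚ) : ℝ) := le_trans h.1.2.2 h.2.2.2
  exact_mod_cast h'

/-! ## The `dE-from-absolutes` rule (ORACLE-SPEC §1.3 (i); REFEREE-CHEM §1.4): interval subtraction -/

/-- **`ΔE_L = L_A − U_B`.** A certified LOWER row for `F_A` and a certified UPPER row for `F_B` give the
difference lower row `L_A − U_B ≤ E₀(A) − E₀(B)` (ORACLE-SPEC §1.3 (i)). -/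
theorem diffLowerRow_of_lowerRow_upperRow {FA : Model kA} {a b : ℕ} {FB : Model kB} {a' b' : ℕ}
    {loA hiB : ℚ} (hA : LowerRow FA a b loA) (hB : UpperRow FB a' b' hiB) :
    DiffLowerRow FA a b FB a' b' (loA - hiB) := by
  refine ⟨hA.range, hB.range, ?_⟩
  have h1 := hA.le
  have h2 := hB.le
  push_cast
  linarith

/-- **`ΔE_U = U_A − L_B`.** A certified UPPER row for `F_A` and a certified LOWER row for `F_B` give the
difference upper row `E₀(A) − E₀(B) ≤ U_A − L_B` (ORACLE-SPEC §1.3 (i)). -/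
theorem diffUpperRow_of_upperRow_lowerRow {FA : Model kA} {a b : ℕ} {FB : Model kB} {a' b' : ℕ}
    {hiA loB : ℚ} (hA : UpperRow FA a b hiA) (hB : LowerRow FB a' b' loB) :
    DiffUpperRow FA a b FB a' b' (hiA - loB) := by
  refine ⟨hA.range, hB.range, ?_⟩
  have h1 := hA.le
  have h2 := hB.le
  push_cast
  linarith

/-- **THE `dE-from-absolutes` RULE** (ORACLE-SPEC §1.3 (i), "always valid; width `W_A + W_B`";
REFEREE-CHEM §1.4 «I-DIFF-trivial»): two certified absolute brackets `[L_A, U_A] ∋ E₀(A)` and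
`[L_B, U_B] ∋ E₀(B)` give the certified difference bracket `L_A − U_B ≤ E₀(A) − E₀(B) ≤ U_A − L_B`. -/
theorem diffBracket_of_brackets {FA : Model kA} {a b : ℕ} {FB : Model kB} {a' b' : ℕ}
    {loA hiA loB hiB : ℚ} (hA : Bracket FA a b loA hiA) (hB : Bracket FB a' b' loB hiB) :
    DiffBracket FA a b FB a' b' (loA - hiB) (hiA - loB) :=
  ⟨diffLowerRow_of_lowerRow_upperRow hA.1 hB.2, diffUpperRow_of_upperRow_lowerRow hA.2 hB.1⟩

/-- **The width of the `dE-from-absolutes` bracket is the SUM of the absolute widths**,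
`(U_A − L_B) − (L_A − U_B) = (U_A − L_A) + (U_B − L_B)` (an identity on the slots; this is why the
rule is uninformative once either absolute width exceeds the decision threshold, LADDER-CHEM §1 R2). -/
theorem width_from_absolutes (loA hiA loB hiB : ℚ) :
    (hiA - loB) - (loA - hiB) = (hiA - loA) + (hiB - loB) := by
  ring

/-- The same identity through the `Width` predicate of `Statement.lean`: the `dE-from-absolutes`
bracket meets a tolerance `tol` iff `W_A + W_B ≤ tol`. -/
theorem width_from_absolutes_iff (loA hiA loB hiB tol : ℚ) :
    Width (loA - hiB) (hiA - loB) tol ↔ (hiA - loA) + (hiB - loB) ≤ tol := by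
  unfold Width
  rw [width_from_absolutes]

/-! ## Antisymmetry under swapping the pair -/

/-- Swapping the pair turns a difference lower row into a difference upper row with the negated slot:
`lo ≤ E₀(A) − E₀(B) ↔ E₀(B) − E₀(A) ≤ −lo`. -/
theorem diffLowerRow_iff_diffUpperRow_swap (FA : Model kA) (a b : ℕ) (FB : Model kB) (a' b' : ℕ)
    (lo : ℚ) : DiffLowerRow FA a b FB a' b' lo ↔ DiffUpperRow FB a' b' FA a b (-lo) := by
  unfold DiffLowerRow DiffUpperRow
  push_cast
  constructor
  · rintro ⟨hA, hB, h⟩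
    exact ⟨hB, hA, by linarith⟩
  · rintro ⟨hB, hA, h⟩
    exact ⟨hA, hB, by linarith⟩

/-- Swapping the pair turns a difference upper row into a difference lower row with the negated slot. -/
theorem diffUpperRow_iff_diffLowerRow_swap (FA : Model kA) (a b : ℕ) (FB : Model kB) (a' b' : ℕ)
    (hi : ℚ) : DiffUpperRow FA a b FB a' b' hi ↔ DiffLowerRow FB a' b' FA a b (-hi) := by
  rw [diffLowerRow_iff_diffUpperRow_swap, neg_neg]

/-- A difference bracket for `(A, B)` is a difference bracket for `(B, A)` with negated, swapped slots:
`[lo, hi] ∋ E₀(A) − E₀(B) ⇒ [−hi, −lo] ∋ E₀(B) − E₀(A)`. -/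
theorem DiffBracket.swap {FA : Model kA} {a b : ℕ} {FB : Model kB} {a' b' : ℕ} {lo hi : ℚ}
    (h : DiffBracket FA a b FB a' b' lo hi) : DiffBracket FB a' b' FA a b (-hi) (-lo) :=
  ⟨(diffUpperRow_iff_diffLowerRow_swap FA a b FB a' b' hi).1 h.2,
    (diffLowerRow_iff_diffUpperRow_swap FA a b FB a' b' lo).1 h.1⟩

/-! ## Chaining along a path `A → B → C` (thermodynamic cycles) -/

/-- **Difference lower rows add along a path**: `lo₁ ≤ E₀(A) − E₀(B)` and `lo₂ ≤ E₀(B) − E₀(C)` give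
`lo₁ + lo₂ ≤ E₀(A) − E₀(C)`. -/
theorem DiffLowerRow.trans {FA : Model kA} {a b : ℕ} {FB : Model kB} {a' b' : ℕ} {FC : Model kC}
    {a'' b'' : ℕ} {lo₁ lo₂ : ℚ} (h₁ : DiffLowerRow FA a b FB a' b' lo₁)
    (h₂ : DiffLowerRow FB a' b' FC a'' b'' lo₂) : DiffLowerRow FA a b FC a'' b'' (lo₁ + lo₂) := by
  refine ⟨h₁.1, h₂.2.1, ?_⟩
  have e₁ := h₁.2.2
  have e₂ := h₂.2.2
  push_cast
  linarith

/-- **Difference upper rows add along a path**: `E₀(A) − E₀(B) ≤ hi₁` and `E₀(B) − E₀(C) ≤ hi₂` give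
`E₀(A) − E₀(C) ≤ hi₁ + hi₂`. -/
theorem DiffUpperRow.trans {FA : Model kA} {a b : ℕ} {FB : Model kB} {a' b' : ℕ} {FC : Model kC}
    {a'' b'' : ℕ} {hi₁ hi₂ : ℚ} (h₁ : DiffUpperRow FA a b FB a' b' hi₁)
    (h₂ : DiffUpperRow FB a' b' FC a'' b'' hi₂) : DiffUpperRow FA a b FC a'' b'' (hi₁ + hi₂) := by
  refine ⟨h₁.1, h₂.2.1, ?_⟩
  have e₁ := h₁.2.2
  have e₂ := h₂.2.2
  push_cast
  linarith

/-- **Difference brackets add along a path** (widths add). -/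
theorem DiffBracket.trans {FA : Model kA} {a b : ℕ} {FB : Model kB} {a' b' : ℕ} {FC : Model kC}
    {a'' b'' : ℕ} {lo₁ hi₁ lo₂ hi₂ : ℚ} (h₁ : DiffBracket FA a b FB a' b' lo₁ hi₁)
    (h₂ : DiffBracket FB a' b' FC a'' b'' lo₂ hi₂) :
    DiffBracket FA a b FC a'' b'' (lo₁ + lo₂) (hi₁ + hi₂) :=
  ⟨h₁.1.trans h₂.1, h₁.2.trans h₂.2⟩

/-! ## Transport of absolute rows across a difference row -/

/-- **An absolute lower row for `F_B` and a difference lower row give an absolute lower row for `F_A`**: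
`lo ≤ E₀(A) − E₀(B)` and `L_B ≤ E₀(B)` give `lo + L_B ≤ E₀(A)` (certify one partner absolutely, reach
the other through the difference certificate). -/
theorem lowerRow_of_diffLowerRow_lowerRow {FA : Model kA} {a b : ℕ} {FB : Model kB} {a' b' : ℕ}
    {lo loB : ℚ} (h : DiffLowerRow FA a b FB a' b' lo) (hB : LowerRow FB a' b' loB) :
    LowerRow FA a b (lo + loB) := by
  refine ⟨h.1.1, h.1.2, ?_⟩
  have e₁ := h.2.2
  have e₂ := hB.le
  push_cast
  linarith

/-- **An absolute upper row for `F_B` and a difference upper row give an absolute upper row for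
`F_A`**: `E₀(A) − E₀(B) ≤ hi` and `E₀(B) ≤ U_B` give `E₀(A) ≤ hi + U_B`. -/
theorem upperRow_of_diffUpperRow_upperRow {FA : Model kA} {a b : ℕ} {FB : Model kB} {a' b' : ℕ}
    {hi hiB : ℚ} (h : DiffUpperRow FA a b FB a' b' hi) (hB : UpperRow FB a' b' hiB) :
    UpperRow FA a b (hi + hiB) := by
  refine ⟨h.1.1, h.1.2, ?_⟩
  have e₁ := h.2.2
  have e₂ := hB.le
  push_cast
  linarith

/-- A difference bracket and an absolute bracket for `F_B` give an absolute bracket for `F_A`. -/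
theorem bracket_of_diffBracket_bracket {FA : Model kA} {a b : ℕ} {FB : Model kB} {a' b' : ℕ}
    {lo hi loB hiB : ℚ} (h : DiffBracket FA a b FB a' b' lo hi) (hB : Bracket FB a' b' loB hiB) :
    Bracket FA a b (lo + loB) (hi + hiB) :=
  ⟨lowerRow_of_diffLowerRow_lowerRow h.1 hB.1, upperRow_of_diffUpperRow_upperRow h.2 hB.2⟩

/-! ## Slot predicates: falsification test and the I-DIFF STEP-0 test (statements about the slots only) -/

/-- Under a difference bracket, a printed reference value for the difference (an FCI or CC reaction
energy read as the rational it prints) lying inside the bracket is within the bracket width of `dE`: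
`|dE − ref| ≤ hi − lo`. -/
theorem abs_energyDiff_sub_ref_le {FA : Model kA} {a b : ℕ} {FB : Model kB} {a' b' : ℕ}
    {lo hi ref : ℚ} (h : DiffBracket FA a b FB a' b' lo hi) (href : RefInside lo hi ref) :
    |FA.energyDiff a b FB a' b' - ((ref : ℚ) : ℝ)| ≤ ((hi - lo : ℚ) : ℝ) := by
  have h1 := h.1.le
  have h2 := h.2.le
  obtain ⟨h3, h4⟩ := href
  have h3' : ((lo : ℚ) : ℝ) ≤ ((ref : ℚ) : ℝ) := by exact_mod_cast h3
  have h4' : ((ref : ℚ) : ℝ) ≤ ((hi : ℚ) : ℝ) := by exact_mod_cast h4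
  push_cast
  rw [abs_le]
  constructor <;> linarith

/-- THE I-DIFF STEP-0 TEST on the slots (LADDER-CHEM §1 row I-DIFF: "STEP-0 pass: certified
`W(ΔE) < ½ (W_A + W_B)`"): a difference bracket `[lo, hi]` BEATS the absolute brackets `[loA, hiA]`,
`[loB, hiB]` when its width is below half the sum of theirs. A decidable statement about six rationals
(close instances by `norm_num [DiffWidthBeatsAbsolutes]`); never a claim about any energy. -/
def DiffWidthBeatsAbsolutes (lo hi loA hiA loB hiB : ℚ) : Prop :=
  hi - lo < ((hiA - loA) + (hiB - loB)) / 2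

/-- The `dE-from-absolutes` bracket NEVER passes the STEP-0 test against its own absolute brackets
(its width IS `W_A + W_B ≥ ½ (W_A + W_B)` whenever the absolute brackets are consistent): only a
genuine difference certificate can. -/
theorem not_diffWidthBeatsAbsolutes_from_absolutes {loA hiA loB hiB : ℚ} (hA : loA ≤ hiA)
    (hB : loB ≤ hiB) : ¬ DiffWidthBeatsAbsolutes (loA - hiB) (hiA - loB) loA hiA loB hiB := by
  unfold DiffWidthBeatsAbsolutes
  rw [width_from_absolutes]
  intro h
  linarith

end Summit.Ventures.CertifiedQuantumChemistry

end
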